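import Summits.HodgeConjecture.HodgeConjecture.Theorems.Ring2AbelianAllCMAlgebraicCarriersDefs
import Literature.AlgebraicGeometry.Motives.SupersingularAbelianVariety
import HarnessLib

/-!
# Ring 2 / AbelianAll (André column) — the node «CARRIERS FOR ALGEBRAIC CLASSES AT ELLIPTIC-POWER ANCHORS» of the implication table
# (definitions only)

research route, not a corollary; conditional on HC_CM plus one named minimal statement.

DEFINITIONS ONLY (nothing asserted, nothing proved; `HC_CM` absent). PART AB (ab-andre-2 gen 59) served ALGEBRAIC classes and recorded clause
(ii) of André's Lemme 6.3.3 as a Literature named fact (`Andre1996.andre1996_cmHodgeClasses_ellipticPowerPencils`: the algebraically anchored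
compact pencils behind the Hodge classes of CM abelian varieties have a fibre isogenous to a power of an elliptic curve). On such a fibre every
rational `(p,p)` class is a KNOWN Lefschetz class (Tate, Murasaki, van Geemen Thm. 4.3 — the tree's proved
`EllipticCurve.hodgeConjectureFor_of_isIsogenous_powSucc`), so the `HC_CM` step of André's reduction asks carriers ONLY on abelian varieties
isogenous to powers of elliptic curves, for algebraic classes. This file NAMES that carrier statement as a node of the §AbelianAll implication
table of `RING2-MAP.md`, in the vocabulary of PART AA-a (`AnchoredCarrierAt`) and PART AB-b (`algebraicServedClasses`):

* `ellipticPowerPolarisedAnchor n` (anchor predicate, reducible): `X` is isomorphic to (the variety underlying) a complex abelian `n`-fold `A₀`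
  ISOGENOUS TO A POWER `E₀^{N+1}` OF AN ELLIPTIC CURVE (`AbelianVariety.IsIsogenous`, `AbelianVariety.powSucc`, `dim E₀ = 1`), and `θ` is a
  polarisation class of `X`.
* `EllipticPowerAlgebraicCarriers 𝒪` (`@[conjecture]`, door-generic): for all `n`, `p` with `2 ≤ p ≤ n − 2`,
  `AnchoredCarrierAt 𝒪 n p (ellipticPowerPolarisedAnchor n) (algebraicServedClasses p)` — on every such `X`, for every polarisation class `θ`
  and every rational ALGEBRAIC (= Lefschetz) class `w` of codimension `p`, an `𝒪`-admissible datum ON `X` with `κ_p = a·w + c_p·θᵖ`, `a ≠ 0`,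
  `κ_q = c_q·θ^q` — a semiregular representative, modulo the `θ`-ray, of a polynomial in divisor classes on a power of an elliptic curve (up
  to isogeny). With the refined Lemmes 6.3.2–6.3.3 and the door it gives `HC_CM` (companion proof file); with Lemme 6.3.1 and
  `CMAlgebraicCarriers 𝒪` as well, `HC_AV` with `HC_CM` idle.
* `EllipticPowerAlgebraicTwistedCarriers` (`@[conjecture]`): the same for the road's twisted door `twistedReflexiveClass C AdmTw`, every `C`
  (`AdmTw := gluableSigmaAdmissible ∨ bfSingleAdmissible`).

Both nodes are OPEN, not in print (no semiregular-representative theorem for Lefschetz classes on powers of elliptic curves is known; Bloch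
1972 asks the question for cycles, Buchweitz–Flenner 2003 construct the map), NOT implied by the Hodge conjecture (which HOLDS on these
varieties: a carrier is more than algebraicity) — HYPOTHESES wherever used, never cited as facts; implied by PART AB-b's `AbelianDesigns 𝒪`
(restriction). References: [cite: Bloch1972Semiregularity, Remark (7.5)] [cite: BuchweitzFlenner2003, §5 Thm. 5.1]
[cite: Andre1996Motifs, Lemme 6.3.3 (ii) (p. 33)] [cite: vanGeemen1994HodgeAV, Lemma 3.7 and Thm. 4.3] [cite: Markman2025SecantWeil, §7.3].
-/

noncomputable section

open CategoryTheory CategoryTheory.Limits AlgebraicGeometry Topology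

namespace Summit.HodgeConjecture.HodgeConjecture.Ring2.AbelianAll

-- the cell's namespace repeats the summit name (`Summit.HodgeConjecture.HodgeConjecture…`), as in every `Ring2*` file
set_option linter.dupNamespace false

open Literature.AlgebraicGeometry Literature.AlgebraicGeometry.Motives
open Literature.AlgebraicGeometry.HodgeTheory
open Literature.AlgebraicTopology.SingularHomology
open Summit.Ventures.HSemireg (ObjClass)
open Summit.HodgeConjecture.HodgeConjecture.Ring2.SemiregularRepresentatives (AnchoredCarrierAt)

/-- **Elliptic-power polarised anchors** (anchor predicate for `AnchoredCarrierAt` / `HasServedFibre`): `X` is isomorphic to a complex abelian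
variety `A₀` of dimension `n` isogenous to a power `E₀^{N+1}` of an elliptic curve `E₀` (`dim E₀ = 1`), and `θ` is a polarisation class of `X`.
Reducible. [cite: Andre1996Motifs, Lemme 6.3.3 (ii) (p. 33)] [cite: vanGeemen1994HodgeAV, Thm. 4.3] -/
abbrev ellipticPowerPolarisedAnchor (n : ℕ) : ∀ X : SchemeOver ℂ, complexBetti X 2 → Prop :=
  fun X θ ↦ (∃ (A₀ E₀ : AbelianVariety ℂ) (N : ℕ), A₀.dim = n ∧ E₀.dim = 1 ∧ A₀.IsIsogenous (E₀.powSucc N) ∧ Nonempty (A₀.X ≅ X)) ∧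
    IsPolarizationClass n X θ

/-- **CARRIERS FOR ALGEBRAIC CLASSES AT ELLIPTIC-POWER ANCHORS for the door `𝒪` (`EllipticPowerAlgebraicCarriers 𝒪`)**: for all `n`, `p`
with `2 ≤ p ≤ n − 2`, on every complex scheme isomorphic to an abelian `n`-fold isogenous to a power of an elliptic curve, for every
polarisation class `θ` and every rational ALGEBRAIC class `w` of codimension `p` (there: every rational `(p,p)` class, a polynomial in divisor
classes): an `𝒪`-admissible datum `(I ∋ p, κ)` ON IT with `κ_p = a·w + c_p·θᵖ`, `a ≠ 0`, `κ_q = c_q·θ^q` (`q ∈ I`, `q ≠ p`). With André's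
Lemmes 6.3.2–6.3.3 (clause (ii) recorded) and the door it gives `HC_CM`. OPEN; a HYPOTHESIS wherever used.
[cite: Bloch1972Semiregularity, Remark (7.5)] [cite: Andre1996Motifs, Lemme 6.3.3 (ii) (p. 33)] [cite: vanGeemen1994HodgeAV, Thm. 4.3] -/
@[conjecture] def EllipticPowerAlgebraicCarriers (𝒪 : ObjClass) : Prop :=
  ∀ n p : ℕ, 2 ≤ p → p + 2 ≤ n → AnchoredCarrierAt 𝒪 n p (ellipticPowerPolarisedAnchor n) (algebraicServedClasses p)

/-- **TWISTED CARRIERS FOR ALGEBRAIC CLASSES AT ELLIPTIC-POWER ANCHORS (`EllipticPowerAlgebraicTwistedCarriers`)**: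
`EllipticPowerAlgebraicCarriers` for the road's twisted door `twistedReflexiveClass C AdmTw` — `B`-twisted admissible perfect complexes,
`AdmTw := gluableSigmaAdmissible ∨ bfSingleAdmissible` — for EVERY Chern character theory `C`. OPEN; not in print; a HYPOTHESIS wherever used.
[cite: Bloch1972Semiregularity, Remark (7.5)] [cite: Markman2025SecantWeil, §7.3] [cite: BuchweitzFlenner2003, §5 Thm. 5.1]
[cite: Andre1996Motifs, Lemme 6.3.3 (ii) (p. 33)] -/
@[conjecture] def EllipticPowerAlgebraicTwistedCarriers : Prop :=
  ∀ C : ChernCharacterBetti, EllipticPowerAlgebraicCarriers (twistedReflexiveClass C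
    (fun n X₀ I E => Summit.Ventures.HSemireg.gluableSigmaAdmissible n X₀ I E ∨
      Literature.AlgebraicGeometry.HodgeTheory.bfSingleAdmissible n X₀ I E))

end Summit.HodgeConjecture.HodgeConjecture.Ring2.AbelianAll

end
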